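import Summits.QuantumFields.YangMills.Theorems.LuscherReductionDressedRitzPolyakovLiftShadowVectorCoeff
import Summits.QuantumFields.YangMills.Theorems.FemtoTransferGapMultiplierIMS
import HarnessLib

/-!
# Route `LuscherReduction`, item `DressedRitz` (stmt-QuantumFields-20205), line «polyakovlift» r6, stub S-PSCAL″ — THE SHADOW VECTOR `v = ins_{e0}(f)`:
# its FIRST-MOMENT SLOP `κ‖v‖² − ⟨v,Kv⟩` in quasimode data (F9-IV; LEAD prover ym-lead-20205-polyakovlift g2)

Setting as in `…ShadowVectorCoeff`: `e0` unit top eigenfunction, `Φ₀` vacuum quasimode, `a = ⟨Φ₀,e0⟩`, `η = Φ₀ − a·e0`, `f` bounded physical multiplier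
with `f·Φ₀ = Ψ` a.e., `x = f·e0`, `v = ins_{e0} f = x − ⟨e0,x⟩e0`, pivot `κ ≤ λ₀`, energy form `P(u) = λ₀‖u‖² − ⟨u,Ku⟩ ≥ 0`.  Then:

* `slop_ins_eq`:   `κ‖v‖² − ⟨v,Kv⟩ = (κ‖x‖² − ⟨x,Kx⟩) + (λ₀ − κ)·⟨e0,x⟩²`  (the vacuum mean only ADDS `(λ₀−κ)c²`);
* `a_sq_slop_x_eq`: `a²(κ‖x‖² − ⟨x,Kx⟩) = P_κ(Ψ) − 2P_κ(Ψ, fη) + P_κ(fη)`, `P_κ(u,w) = κ⟨u,w⟩ − ⟨u,Kw⟩` (a.e. congruence `a·x = Ψ − fη`);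
* ★ `energy_mul_le_cs`: `P(fη) ≤ C_f²·‖η‖·‖λ₀η − Kη‖ + ½M‖η‖²` (infvol-p1's `energy_mul_le_su2` + Cauchy–Schwarz), `M` a defect-row bound of `f`;
* ★ `a_sq_slop_ins_le`: the packaged bound
  `a²(κ‖v‖² − ⟨v,Kv⟩) ≤ (κ − θ_Ψ)‖Ψ‖² + 2(√(P(Ψ)·P(fη)) + (λ₀ − κ)‖Ψ‖‖fη‖) + P(fη) + (λ₀ − κ)·a²⟨e0,x⟩²` with `P(Ψ) ≤ (λ₀ − θ_Ψ)‖Ψ‖²`.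

HONEST FRAMING: fixed-lattice bookkeeping (conditional femto rung R2b1); nothing here bears on infinite volume, the continuum limit or the Clay gap.
References: Reed–Simon IV, Thm. XIII.1 [cite: ReedSimonIV1978, Thm. XIII.1]; B. Simon (1983) §3 [cite: SimonB1983DiscreteSpectrum, §3].
-/

set_option autoImplicit false

noncomputable section

open MeasureTheory Filter Topology Real
open Literature.MathematicalPhysics.QuantumFieldTheory (GaugeConfig Site gaugeTransform)
open scoped BigOperators

namespace Summit.QuantumFields.YangMills.Theorems.FemtoTransferGap.PScal

open Summit.QuantumFields.YangMills.Theorems.FemtoTransferGap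
open Summit.QuantumFields.YangMills.Theorems.FemtoTransferGap.VacDict (l2_mul_self_le abs_l2_le_sqrt_mul_sqrt)

variable {L : ℕ} [NeZero L] {β : ℝ} {e0 Φ₀ Ψ f : GaugeConfig 3 L SU2 → ℝ}

/-- The bilinear pivot form `P_κ(u,w) = κ⟨u,w⟩ − ⟨u,Kw⟩` on the physical subspace. [folklore] -/
def pivotForm (L : ℕ) [NeZero L] (β κ : ℝ) : physSubmodule L →ₗ[ℝ] physSubmodule L →ₗ[ℝ] ℝ :=
  κ • l2Form L - (l2Form L).compl₂ (transferOp β)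

/-- `pivotForm` unfolded. [folklore] -/
theorem pivotForm_apply (κ : ℝ) (u w : physSubmodule L) :
    pivotForm L β κ u w = κ * l2 (u : GaugeConfig 3 L SU2 → ℝ) w - qform su2Rep β (u : GaugeConfig 3 L SU2 → ℝ) w := by
  simp only [pivotForm, LinearMap.sub_apply, LinearMap.smul_apply, LinearMap.compl₂_apply, smul_eq_mul, l2Form_apply, coe_transferOp,
    l2_transferApply_eq_qform]

/-- `⟨e, K y⟩ = λ·⟨e, y⟩` for an exact physical eigenfunction `K e = λ e` and physical `y`. [folklore] -/
theorem qform_eigen_left (β : ℝ) {lam : ℝ} {e y : GaugeConfig 3 L SU2 → ℝ} (he : IsPhys e) (hy : IsPhys y)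
    (heig : transferApply β e = lam • e) : qform su2Rep β e y = lam * l2 e y := by
  rw [qform_eq_l2_transferApply, ← l2_transferApply_comm β he hy, heig, l2_smul_left]

/-- `⟨y, K e⟩ = λ·⟨y, e⟩`. [folklore] -/
theorem qform_eigen_right (β : ℝ) {lam : ℝ} {e y : GaugeConfig 3 L SU2 → ℝ} (heig : transferApply β e = lam • e) :
    qform su2Rep β y e = lam * l2 y e := by
  rw [qform_eq_l2_transferApply, heig, l2_comm, l2_smul_left, l2_comm]

/-- `qform (a • x) (a • x) = a² · qform x x`. [folklore] -/
theorem qform_smul_smul (a : ℝ) (x : GaugeConfig 3 L SU2 → ℝ) : qform su2Rep β (a • x) (a • x) = a ^ 2 * qform su2Rep β x x := by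
  rw [qform_smul_left, qform_eq_l2_transferApply, transferApply_smul, l2_comm, l2_smul_left, l2_comm, ← qform_eq_l2_transferApply]; ring

/-! ## §1 The vacuum mean only adds `(λ₀ − κ)c²` -/

/-- ★ `κ‖v‖² − ⟨v,Kv⟩ = (κ‖x‖² − ⟨x,Kx⟩) + (λ₀ − κ)⟨e0,x⟩²` for `v = ins_{e0} f`, `x = f·e0`, `K e0 = λ₀ e0`, `‖e0‖ = 1`. [cite: ReedSimonIV1978, Thm. XIII.1] -/
theorem slop_ins_eq (he0 : IsPhys e0) (hn0 : l2 e0 e0 = 1) (heig0 : transferApply β e0 = levelValue su2Rep L β 0 • e0) (hf : IsPhys f) (κ : ℝ) :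
    κ * l2 (OpPlat.ins e0 f) (OpPlat.ins e0 f) - qform su2Rep β (OpPlat.ins e0 f) (OpPlat.ins e0 f) =
      (κ * l2 (f * e0) (f * e0) - qform su2Rep β (f * e0) (f * e0)) + (levelValue su2Rep L β 0 - κ) * l2 e0 (f * e0) ^ 2 := by
  have hfe : IsPhys (f * e0) := OpPlat.isPhys_mul hf he0
  set c := l2 e0 (f * e0) with hc
  set l0 := levelValue su2Rep L β 0 with hl0
  have hnorm := normSq_ins_eq (e0 := e0) (f := f) he0 hn0 hf
  -- the form `Q u w = ⟨u, K w⟩` on the physical subspace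
  let Q : physSubmodule L →ₗ[ℝ] physSubmodule L →ₗ[ℝ] ℝ := (l2Form L).compl₂ (transferOp β)
  have hQ : ∀ u w : physSubmodule L, Q u w = qform su2Rep β (u : GaugeConfig 3 L SU2 → ℝ) w := fun u w => by
    simp only [Q, LinearMap.compl₂_apply, l2Form_apply, coe_transferOp, l2_transferApply_eq_qform]
  set xs : physSubmodule L := ⟨f * e0, hfe⟩
  set es : physSubmodule L := ⟨e0, he0⟩
  have hins : OpPlat.ins e0 f = ((xs - c • es : physSubmodule L) : GaugeConfig 3 L SU2 → ℝ) := by rw [OpPlat.ins_eq]; rfl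
  have hexp : Q (xs - c • es) (xs - c • es) = Q xs xs - c * Q xs es - c * Q es xs + c ^ 2 * Q es es := by
    simp only [map_sub, map_smul, LinearMap.sub_apply, LinearMap.smul_apply, smul_eq_mul]; ring
  have h1 : Q xs es = l0 * c := by rw [hQ]; show qform su2Rep β (f * e0) e0 = l0 * c; rw [qform_eigen_right β heig0, hc, l2_comm]
  have h2 : Q es xs = l0 * c := by rw [hQ]; show qform su2Rep β e0 (f * e0) = l0 * c; rw [qform_eigen_left β he0 hfe heig0]
  have h3 : Q es es = l0 := by rw [hQ]; show qform su2Rep β e0 e0 = l0; rw [qform_eigen_left β he0 he0 heig0, hn0, mul_one]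
  have hq : qform su2Rep β (OpPlat.ins e0 f) (OpPlat.ins e0 f) = qform su2Rep β (f * e0) (f * e0) - l0 * c ^ 2 := by
    rw [hins, ← hQ, hexp, h1, h2, h3, hQ]; ring
  rw [hnorm, hq]; ring

/-! ## §2 The slop of `x = f·e0` in quasimode data -/

/-- ★ `a²(κ‖x‖² − ⟨x,Kx⟩) = P_κ(Ψ,Ψ) − 2P_κ(Ψ,fη) + P_κ(fη,fη)` with `a·x = Ψ − fη` a.e. [folklore] -/
theorem a_sq_slop_x_eq (hΨ : IsPhys Ψ) (hprod : f * Φ₀ =ᵐ[configMeasure SU2 L] Ψ)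
    (a κ : ℝ) (hfη : IsPhys (f * (Φ₀ - a • e0))) :
    a ^ 2 * (κ * l2 (f * e0) (f * e0) - qform su2Rep β (f * e0) (f * e0)) =
      pivotForm L β κ ⟨Ψ, hΨ⟩ ⟨Ψ, hΨ⟩ - 2 * pivotForm L β κ ⟨Ψ, hΨ⟩ ⟨f * (Φ₀ - a • e0), hfη⟩ +
        pivotForm L β κ ⟨f * (Φ₀ - a • e0), hfη⟩ ⟨f * (Φ₀ - a • e0), hfη⟩ := by
  have hae := a_mul_fe0_ae (e0 := e0) hprod a
  set y := f * (Φ₀ - a • e0) with hy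
  -- a²(κ‖x‖² − q(x)) = κ‖a x‖² − q(a x, a x) = κ‖Ψ−y‖² − q(Ψ−y)
  have h1 : a ^ 2 * (κ * l2 (f * e0) (f * e0) - qform su2Rep β (f * e0) (f * e0)) =
      κ * l2 (Ψ - y) (Ψ - y) - qform su2Rep β (Ψ - y) (Ψ - y) := by
    rw [← l2_congr_ae_left hae, ← l2_congr_ae_right hae, ← qform_congr_ae hae hae, OpPlat.l2_smul_smul, qform_smul_smul]
    ring
  have hsymm : ∀ u w : physSubmodule L, pivotForm L β κ u w = pivotForm L β κ w u := fun u w => by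
    rw [pivotForm_apply, pivotForm_apply, l2_comm, qform_su2Rep_comm β (isPhys_coe u) (isPhys_coe w)]
  have h2 : pivotForm L β κ ((⟨Ψ, hΨ⟩ : physSubmodule L) - ⟨y, hfη⟩) ((⟨Ψ, hΨ⟩ : physSubmodule L) - ⟨y, hfη⟩) =
      pivotForm L β κ ⟨Ψ, hΨ⟩ ⟨Ψ, hΨ⟩ - 2 * pivotForm L β κ ⟨Ψ, hΨ⟩ ⟨y, hfη⟩ + pivotForm L β κ ⟨y, hfη⟩ ⟨y, hfη⟩ := by
    simp only [map_sub, LinearMap.sub_apply, hsymm ⟨y, hfη⟩ ⟨Ψ, hΨ⟩]; ring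
  rw [h1, ← h2, pivotForm_apply, Submodule.coe_sub]

/-! ## §3 The soft error's energy: infvol-p1's product lemma + Cauchy–Schwarz -/

/-- ★ `P(fη) ≤ C_f²·‖η‖·‖λ₀η − Kη‖ + ½M‖η‖²` for a physical bounded multiplier `f` with defect-row bound `M`. [cite: SimonB1983DiscreteSpectrum, §3] -/
theorem energy_mul_le_cs {η : GaugeConfig 3 L SU2 → ℝ} (hη : IsPhys η) (hf : IsPhys f) {Cf : ℝ} (hCf : ∀ U, |f U| ≤ Cf)
    {M : ℝ} (hM : ∀ U, ∫ V, transferKernel su2Rep β U V * (f U - f V) ^ 2 ∂configMeasure SU2 L ≤ M) :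
    levelValue su2Rep L β 0 * l2 (f * η) (f * η) - qform su2Rep β (f * η) (f * η) ≤
      Cf ^ 2 * (Real.sqrt (l2 η η) * Real.sqrt (l2 (levelValue su2Rep L β 0 • η - transferApply β η) (levelValue su2Rep L β 0 • η - transferApply β η)))
        + (1 / 2) * M * l2 η η := by
  set l0 := levelValue su2Rep L β 0
  have h := energy_mul_le_su2 β hf.measurable hCf (fun k U => hf.gaugeInv k U) (fun k z hz U => hf.zeroFlux k z hz U) hM hη l0
  have hf2η : IsPhys (fun U => f U ^ 2 * η U) :=
    IsPhys.sq_mul_of_invariant hη hf.measurable hCf (fun k U => hf.gaugeInv k U) (fun k z hz U => hf.zeroFlux k z hz U)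
  have hres : IsPhys (l0 • η - transferApply β η) := ((l0 • (⟨η, hη⟩ : physSubmodule L)) - transferOp β ⟨η, hη⟩).2
  -- `l0·⟨f²η,η⟩ − ⟨f²η,Kη⟩ = ⟨f²η, l0η − Kη⟩ ≤ ‖f²η‖‖l0η − Kη‖ ≤ C_f²‖η‖‖l0η − Kη‖`
  have h1 : l0 * l2 (fun U => f U ^ 2 * η U) η - l2 (fun U => f U ^ 2 * η U) (transferApply β η) =
      l2 (fun U => f U ^ 2 * η U) (l0 • η - transferApply β η) := by
    have h := (l2Form L ⟨fun U => f U ^ 2 * η U, hf2η⟩).map_sub (l0 • (⟨η, hη⟩ : physSubmodule L)) (transferOp β ⟨η, hη⟩)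
    simp only [map_smul, l2Form_apply, Submodule.coe_sub, Submodule.coe_smul, coe_transferOp, smul_eq_mul] at h
    linarith [h]
  have h2 : l2 (fun U => f U ^ 2 * η U) (l0 • η - transferApply β η) ≤
      Real.sqrt (l2 (fun U => f U ^ 2 * η U) (fun U => f U ^ 2 * η U)) * Real.sqrt (l2 (l0 • η - transferApply β η) (l0 • η - transferApply β η)) :=
    (le_abs_self _).trans (abs_l2_le_sqrt_mul_sqrt hf2η hres)
  have h3 : l2 (fun U => f U ^ 2 * η U) (fun U => f U ^ 2 * η U) ≤ (Cf ^ 2) ^ 2 * l2 η η := by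
    have hf2 : IsPhys (fun U => f U ^ 2) := by
      have := OpPlat.isPhys_mul hf hf
      have e : (f * f) = fun U => f U ^ 2 := by funext U; simp [sq]
      rwa [e] at this
    have := l2_mul_self_le (f := fun U => f U ^ 2) hf2 hη (C := Cf ^ 2) (fun U => by
      simp only [abs_pow]; exact pow_le_pow_left₀ (abs_nonneg _) (hCf U) 2)
    exact this
  have h4 : Real.sqrt (l2 (fun U => f U ^ 2 * η U) (fun U => f U ^ 2 * η U)) ≤ Cf ^ 2 * Real.sqrt (l2 η η) := by
    rw [← Real.sqrt_sq (sq_nonneg Cf), ← Real.sqrt_mul (sq_nonneg _)]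
    exact Real.sqrt_le_sqrt h3
  have hR0 : 0 ≤ Real.sqrt (l2 (l0 • η - transferApply β η) (l0 • η - transferApply β η)) := Real.sqrt_nonneg _
  have hfη_eq : (fun U => f U * η U) = f * η := rfl
  rw [hfη_eq] at h
  calc l0 * l2 (f * η) (f * η) - qform su2Rep β (f * η) (f * η)
      ≤ (l0 * l2 (fun U => f U ^ 2 * η U) η - l2 (fun U => f U ^ 2 * η U) (transferApply β η)) + (1 / 2) * M * l2 η η := h
    _ ≤ Cf ^ 2 * (Real.sqrt (l2 η η) * Real.sqrt (l2 (l0 • η - transferApply β η) (l0 • η - transferApply β η))) + (1 / 2) * M * l2 η η := by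
        rw [h1]
        have := mul_le_mul_of_nonneg_right h4 hR0
        linarith [h2]

end Summit.QuantumFields.YangMills.Theorems.FemtoTransferGap.PScal

end
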